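import Summits.QuantumFields.YangMills.Theorems.BalabanUVNodesN21LowCentreEndAtSUNBlockChartRecordAnalyticLocal
import Summits.QuantumFields.YangMills.Theorems.BalabanUVNodesN21ChartExponentCoercivityAxialComb

/-!
# N21 (NE7c) · THE [LF-II] §1-LETTERS END ON THE EXPONENTIAL `SU(N)` BLOCK CHART, II⁗: the UNDRESSED record species with
# `h19` read from the (1.7) row ON THE OFF-TREE BLOCK `castBond '' (innerBonds n y ∖ treeBonds n y)` OF A TORUS BOX — no bond
# dictionary displayed: dag-n21-w3 g5's `…CoercivityAxialComb.ineq19_blockChartSU_image_of_ineq17` supplies it (the lane's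
# comb-gauge box `[lo, hi]` is the case `n = sides, y = lo`, `castBond_injOn_innerBonds`)

Width seat pub-ymgap-dag-n21-w4 (g6; director-ym R399 (3a) ∕ HUMAN RULING D-0149; dag-lead g18 DEDUP-398 pattern (a), first
refusal RELEASED BY NAME by dag-n21-w1 g4 «n21-w4 take (a)», bus 2026-08-28T14:17:49Z — «optionally the off-comb twin»), node
N21 = NE7c (single-run shell-weight bound, NOT PRINTED in [Bałaban 1983–89], NOT proved), lane K3⁸ `SpineGivenEndpointR13SepCoPHV`
(stmt-QuantumFields-27366, `--kind proof --supports … --as helper`; lineage K3⁷ 20544).  File 4 of this seat's chain: the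
OFF-COMB edition of file 2 `…N21LowCentreEndAtSUNBlockChartRecordAnalyticLocal` (p614928: the three ★-loc UNDRESSED record
theorems, `h19` displayed); companion of file 3 `…RecordAnalyticBox` (the box bond dictionary `e` displayed) and of dag-n21-w1
g4's `…PackageCoerciveAxialComb` (the same re-knit for the DRESSED per-fibre package, whose species — block PINNED by a
hypothesis `hbdef`, `subst` + one `exact` — is followed here).  Consumes BY NAME dag-n21-w3 g5's
`…N21ChartExponentCoercivityAxialComb` (p639994: ★★ `ineq19_blockChartSU_image_of_ineq17`).  THEOREMS ONLY: 0 `def`,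
0 `sorry`; count-neutral.  NO Theses import.  Restates nothing.

WHAT IS PROVED ([bookkeeping]: `subst hbdef` + one term each — file 2's three ★-loc VERBATIM at `d := P.d` with the displayed
(1.9) binder `h19` REPLACED by: the block `b = castBond '' (innerBonds n y ∖ treeBonds n y)` of a `ℤ^d` box `box n y` (sides
`n_κ ≤ 100M`, `M : ℕ`, `0 < M`) on whose inner bonds `castBond` is INJECTIVE (`hinj`; e.g. every non-wrapping box,
`N21AxialCombDictionary.castBond_injOn_innerBonds`), print's (1.7) row `h17` asked for every chart vector against the curl
energy of its extension by ZERO to all torus bonds PULLED BACK along `castBond`, and the smallness line `hsmall`; inside,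
`h19 := ineq19_blockChartSU_image_of_ineq17 hinj M hd hnM hM Qf hγ₀.le h17 hsmall`):
* §1 ★-img `slotAntiConcentration_blockChartSU_chartLetter_analytic_image` (the chart-letter species);
* §2 ★-img `fibreAC_of_sect1Letters_expChartSU_analytic_image` ∕ ★-img `termFibreAC_of_sect1Letters_expChartSU_analytic_image`
  (the END at one block ∕ one term fibre law of the record; dag-n21-w2's junction №3 letters `hlaw` ∕ `hdens` ∕ `hread` verbatim).
At the lane's own tree-gauge letters (comb `T := combBonds lo hi` of a non-wrapping torus box with sides `≤ 100M`, block = the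
box bonds OFF the comb = `boxBonds lo hi ∖ combSet lo hi`, dag-n21-w3 g5's `N21AxialCombDictionary` §2) the block IS this `b`
with `n = fun κ ↦ (hi κ + 1 − lo κ).toNat`, `y = lo`.

HONEST FRAMING.  Composition BY NAME of landed files (p614928 ∕ p639994 credited); the (1.7) row `h17` (about NODE O's
operator `Δ₁(ζ₀)` on the box), the (1.2) expansion's identification, the analyticity letter (`Φ`, `r`, `S`), `hlaw` ∕ `hdens` ∕
`hread`, the statistic binders, the odds and the clauses remain the consumer's HYPOTHESES (NODE O's term object ∕ located
letters), NOT asserted; WHICH box the lane's (M1) package fixes is the measure side's decision (dag-n21-w2 ∕ dag-n21-d);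
nothing of Bałaban's asserted; (M1) ∕ NE7c NOT PRINTED ∕ NOT proved; **N21 NOT discharged**; K3⁸ NOT claimed; counts unmoved
(typed 28∕28 · discharged 5∕27); never a count claim; one finite 𝕋⁴ at fixed ε — R4 would close only the conditional
finite-𝕋⁴ rung `BalabanLadder.UV`, NOT the Yang–Mills mass gap (Clay); nothing about ℝ⁴ ∕ OS.  No decl below carries a cite
tag.
-/

set_option autoImplicit false

noncomputable section

open MeasureTheory Set Function Finset Matrix Metric
open scoped ENNReal BigOperators

namespace Summit.QuantumFields.YangMills.Theorems.N21LowCentreEndAtSUNBlockChartRecordAnalyticAxialComb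

open Literature.MathematicalPhysics.QuantumFieldTheory.Balaban1983to89
open Literature.MathematicalPhysics.QuantumFieldTheory.Balaban1983to89.T4Continuum
open Literature.MathematicalPhysics.QuantumFieldTheory.Balaban1983to89.Node00 hiding dimSU
open Literature.MathematicalPhysics.QuantumFieldTheory.Balaban1983to89.T4ShellMeasure (SlotAntiConcentration)
open Literature.MathematicalPhysics.QuantumFieldTheory.Balaban1983to89.T4ShellMeasureDet (blockLaw)
open Literature.MathematicalPhysics.QuantumFieldTheory.Balaban1983to89.B16Sect1Wilson (Ineq16 Ineq17 Ineq19)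
open Literature.MathematicalPhysics.QuantumFieldTheory.Balaban1983to89.B6TreeGaugePoincare (curl)
open Literature.MathematicalPhysics.QuantumFieldTheory.Balaban1983to89.B16Eq18Proof (innerBonds treeBonds innerPlaq)
open Literature.MathematicalPhysics.QuantumFieldTheory.Balaban1983to89.T4AxialGaugeSmallField (castSite)
open Summit.QuantumFields.BalabanUV.T4Continuum.ShellMeasureExpChartSUN
  (SUN ChartSU BlockChartSU dimSU expFibreChartSU chartWeightSU)
open Summit.QuantumFields.BalabanUV.T4Continuum.ShellMeasureScalingSUN (windowSU)
open Summit.QuantumFields.BalabanUV.T4Continuum.ShellMeasureExpJacobianSUN (expJacWeightSU)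
open Summit.QuantumFields.BalabanUV.T4Continuum.ShellMeasureExpHaarAreaSUN (kappaSU)
open Summit.QuantumFields.YangMills.Theorems.N21ShellSplitOfRecord13CoPH (blockReading blockFibreLawOfDatum₉ termFibreLawOfDatum₉)
open Summit.QuantumFields.YangMills.Theorems.N21LowCentreEndAtSUNBlockChartRecordAnalyticLocal
  (slotAntiConcentration_blockChartSU_chartLetter_analytic_local fibreAC_of_sect1Letters_expChartSU_analytic_local
    termFibreAC_of_sect1Letters_expChartSU_analytic_local)
open Summit.QuantumFields.YangMills.Theorems.N21ChartExponentCoercivityAxialComb (ineq19_blockChartSU_image_of_ineq17)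

/-! ## §1  ★-img The chart-letter species: `h19` from the (1.7) row on the off-tree block of a torus box -/

section ChartLetter

variable {N : ℕ} {P : Params} {j : ℕ}

/-- ★-img **(M1) FOR THE CHART's OWN LETTER `‖z‖ = max_{b′} ‖B′(b′)‖` UNDER THE CUT (1.2) CHART LAW — `h19` READ FROM THE
(1.7) ROW ON THE OFF-TREE BLOCK OF A TORUS BOX.**  File 2's ★-loc `slotAntiConcentration_blockChartSU_chartLetter_analytic_local`
at `d := P.d` with the displayed (1.9) binder `h19` REPLACED by the block `b = castBond '' (innerBonds n y ∖ treeBonds n y)` of a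
`ℤ^d` box with `castBond` injective on its inner bonds (sides `n_κ ≤ 100M`, `M : ℕ`), print's (1.7) row for every chart vector
and the smallness line — `h19` is then dag-n21-w3 g5's `ineq19_blockChartSU_image_of_ineq17`.  Every other binder verbatim
(with `M` read as `(M : ℝ)`). [bookkeeping] -/
theorem slotAntiConcentration_blockChartSU_chartLetter_analytic_image (hN : 2 ≤ N) (b : Finset (PBond P j))
    (hb : b.Nonempty) (K : Set (BlockChartSU N b)) (φ Qf lin Vt : BlockChartSU N b → ℝ)
    (hg : Measurable fun z : BlockChartSU N b => K.indicator (fun w => ENNReal.ofReal (Real.exp (-φ w))) z)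
    {θ ρ γ₀ B₃ M₀ A₀ p₀g Rk WV Cc εk : ℝ} (M : ℕ) {n : Fin P.d → ℕ}
    (hθ : 0 < θ) (hρ0 : 0 < ρ) (hρ1 : ρ < 1) (hd : 1 ≤ P.d) (hM : 0 < M) (hγ₀ : 0 < γ₀)
    (hW : 0 ≤ 3 * B₃ * M₀ * A₀ ^ 2 * p₀g ^ 2 * Real.exp (-Rk) * (100 * (M : ℝ)) ^ 4 + WV)
    (hK : Convex ℝ K) (h0K : (0 : BlockChartSU N b) ∈ K)
    (hexp : ∀ v ∈ K, φ v = φ 0 + 1 / 2 * Qf v + lin v + Vt v)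
    (A : Matrix (↥b × Fin (dimSU N)) (↥b × Fin (dimSU N)) ℝ)
    (hQf : ∀ v, Qf v = (fun q : ↥b × Fin (dimSU N) => v q.1 q.2) ⬝ᵥ (A *ᵥ fun q => v q.1 q.2))
    -- the (1.7) row on the block `castBond '' (innerBonds n y ∖ treeBonds n y)` of a box with `castBond` injective, and the
    -- smallness line, replacing `h19`
    (hnM : ∀ κ, n κ ≤ 100 * M) (y : Fin P.d → ℤ)
    (hinj : Set.InjOn (fun bd : (Fin P.d → ℤ) × Fin P.d => (⟨castSite bd.1, bd.2⟩ : PBond P j)) ↑(innerBonds n y))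
    (hbdef : b = (innerBonds n y \ treeBonds n y).image
      fun bd : (Fin P.d → ℤ) × Fin P.d => (⟨castSite bd.1, bd.2⟩ : PBond P j))
    (h17 : ∀ v : BlockChartSU N b, Ineq17 (Qf v)
      (∑ p ∈ innerPlaq n y, ∑ a : Fin (dimSU N),
        curl (fun bd => if h : (⟨castSite bd.1, bd.2⟩ : PBond P j) ∈ b
            then v ⟨(⟨castSite bd.1, bd.2⟩ : PBond P j), h⟩ a else (0 : ℝ)) p.1 p.2.1 p.2.2 ^ 2)
      (∑ i, ‖v i‖ ^ 2) γ₀ Cc M Rk εk)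
    (hsmall : Cc * ((M : ℝ) ^ 6 * Rk * εk + Real.exp (-Rk)) ≤ γ₀ / (2 * P.d * (100 * (M : ℝ)) ^ (P.d + 1)))
    (h16 : ∀ v ∈ K, Ineq16 (lin v) B₃ M₀ A₀ p₀g Rk M)
    (ℓ : BlockChartSU N b →ₗ[ℝ] ℝ) (hlin : ∀ v, lin v = ℓ v)
    (hV : ∀ v ∈ K, |Vt v| ≤ WV)
    (Φ : (↥b × Fin (dimSU N) → ℂ) → ℂ) {r S : ℝ} (hr : 0 < r)
    (hVtΦ : ∀ x ∈ K, Vt x = (Φ fun q => ((x q.1 q.2 : ℝ) : ℂ)).re)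
    (hΦd : ∀ x ∈ K, DifferentiableOn ℂ Φ (ball (fun q => ((x q.1 q.2 : ℝ) : ℂ)) r))
    (hΦS : ∀ x ∈ K, ∀ u ∈ ball (fun q : ↥b × Fin (dimSU N) => ((x q.1 q.2 : ℝ) : ℂ)) r, ‖Φ u‖ ≤ S)
    (hconv : 4 * P.d * (100 * (M : ℝ)) ^ (P.d + 1) * S ≤ γ₀ * r ^ 2)
    -- the END clause of the chart-letter species
    (hclause : 16 * (3 * B₃ * M₀ * A₀ ^ 2 * p₀g ^ 2 * Real.exp (-Rk) * (100 * (M : ℝ)) ^ 4 + WV) * P.d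
      * (100 * (M : ℝ)) ^ (P.d + 1) * dimSU N ≤ γ₀ * (θ * (1 - ρ)) ^ 2) :
    SlotAntiConcentration
      (((volume : Measure (BlockChartSU N b)).withDensity fun z =>
          K.indicator (fun w => ENNReal.ofReal (Real.exp (-φ w))) z).restrict
        ({z : BlockChartSU N b | ‖z‖ < θ} ∩ univ))
      (fun z : BlockChartSU N b => ‖z‖) θ ρ (3 * ((b.card : ℝ) * dimSU N + 1) * (1 + 0) / (1 * (1 - ρ))) := by
  subst hbdef
  exact slotAntiConcentration_blockChartSU_chartLetter_analytic_local hN _ hb K φ Qf lin Vt hg hθ hρ0 hρ1 hd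
    (by exact_mod_cast hM) hγ₀ hW hK h0K hexp A hQf
    (ineq19_blockChartSU_image_of_ineq17 hinj M hd hnM hM Qf hγ₀.le h17 hsmall)
    h16 ℓ hlin hV Φ hr hVtΦ hΦd hΦS hconv hclause

end ChartLetter

/-! ## §2  ★-img The END at one block ∕ term fibre law of the record: `h19` from the (1.7) row on the off-tree block -/

section AtRecord

variable (F : T4Family) (N : ℕ) [NeZero N] (ϑ : Stage9Params F N) (Dt : FiniteEpsData F (SU N)) (g₀ : ℕ → ℝ)
  (os : List (ULoop F)) (p : B12.RunParams) (g : ℕ → ℝ) (k : ℕ)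

/-- ★-img **THE [LF-II] §1-LETTERS END AT ONE BLOCK FIBRE LAW OF THE RECORD THROUGH THE EXPONENTIAL `SU(N)` BLOCK CHART —
`h19` READ FROM THE (1.7) ROW ON THE OFF-TREE BLOCK OF A TORUS BOX.**  File 2's ★-loc
`fibreAC_of_sect1Letters_expChartSU_analytic_local` at `d := (F.P p.K).d` with `h19` REPLACED by the block
`b = castBond '' (innerBonds n y ∖ treeBonds n y)` (`castBond` injective on the box's inner bonds), the (1.7) row `h17` and the
smallness line (`h19 := ineq19_blockChartSU_image_of_ineq17 …`); dag-n21-w2's JUNCTION №3 letters `hlaw`, `hdens`, `hread`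
and every other binder verbatim.  LOCATED junction. [bookkeeping] -/
theorem fibreAC_of_sect1Letters_expChartSU_analytic_image (hN : 2 ≤ N) (t : ℝ)
    (a : ↥(cubeIndices (F.P p.K) (cubeSide (F.P p.K).L ϑ.ν.M₂ (RkOfRecord (F.P p.K).L ϑ.ν.r (g k)) k)))
    (b : Finset (PBond (F.P p.K) k)) (hb : b.Nonempty) (x : GaugeField (F.P p.K) k (SU N))
    {S : ℝ} (hS : 0 ≤ S) (hSπ : S ≤ Real.pi) (c : GaugeField (F.P p.K) k (SU N))
    {R : (↥b → SU N) → ℝ≥0∞} (hR : Measurable R)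
    (hlaw : blockFibreLawOfDatum₉ F N ϑ Dt g₀ os p g k t a b x = (blockLaw b).withDensity fun y => windowSU b c S y * R y)
    {u : GaugeField (F.P p.K) k (SU N) → ℝ} (hu : Measurable u)
    -- §1's frame on the chart space
    (K : Set (BlockChartSU N b)) (φ Qf lin Vt : BlockChartSU N b → ℝ)
    (hg : Measurable fun z : BlockChartSU N b => K.indicator (fun w => ENNReal.ofReal (Real.exp (-φ w))) z)
    {U : BlockChartSU N b → ℝ} (hUm : Measurable U)
    {C Env : Set (BlockChartSU N b)} (hC : MeasurableSet C) (hEnv : MeasurableSet Env)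
    {θ ρ σ κ₀ Q L γ₀ B₃ M₀ A₀ p₀g Rk WV Cc εk : ℝ} (M : ℕ) {n : Fin (F.P p.K).d → ℕ}
    (hθ : 0 < θ) (hρ0 : 0 < ρ) (hρ1 : ρ < 1) (hρσ : ρ + σ ≤ 1) (hκ : 0 < κ₀) (hQ0 : 0 ≤ Q) (hL : 0 < L)
    (hd : 1 ≤ (F.P p.K).d) (hM : 0 < M) (hγ₀ : 0 < γ₀)
    (hW : 0 ≤ 3 * B₃ * M₀ * A₀ ^ 2 * p₀g ^ 2 * Real.exp (-Rk) * (100 * (M : ℝ)) ^ 4 + WV)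
    (hK : Convex ℝ K) (h0K : (0 : BlockChartSU N b) ∈ K)
    (hexp : ∀ v ∈ K, φ v = φ 0 + 1 / 2 * Qf v + lin v + Vt v)
    (A : Matrix (↥b × Fin (dimSU N)) (↥b × Fin (dimSU N)) ℝ)
    (hQf : ∀ v, Qf v = (fun q : ↥b × Fin (dimSU N) => v q.1 q.2) ⬝ᵥ (A *ᵥ fun q => v q.1 q.2))
    -- the (1.7) row on the block `castBond '' (innerBonds n y ∖ treeBonds n y)` of a box with `castBond` injective, and the
    -- smallness line, replacing `h19`
    (hnM : ∀ κ, n κ ≤ 100 * M) (y : Fin (F.P p.K).d → ℤ)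
    (hinj : Set.InjOn (fun bd : (Fin (F.P p.K).d → ℤ) × Fin (F.P p.K).d => (⟨castSite bd.1, bd.2⟩ : PBond (F.P p.K) k))
      ↑(innerBonds n y))
    (hbdef : b = (innerBonds n y \ treeBonds n y).image
      fun bd : (Fin (F.P p.K).d → ℤ) × Fin (F.P p.K).d => (⟨castSite bd.1, bd.2⟩ : PBond (F.P p.K) k))
    (h17 : ∀ v : BlockChartSU N b, Ineq17 (Qf v)
      (∑ q ∈ innerPlaq n y, ∑ a' : Fin (dimSU N),
        curl (fun bd => if h : (⟨castSite bd.1, bd.2⟩ : PBond (F.P p.K) k) ∈ b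
            then v ⟨(⟨castSite bd.1, bd.2⟩ : PBond (F.P p.K) k), h⟩ a' else (0 : ℝ)) q.1 q.2.1 q.2.2 ^ 2)
      (∑ i, ‖v i‖ ^ 2) γ₀ Cc M Rk εk)
    (hsmall : Cc * ((M : ℝ) ^ 6 * Rk * εk + Real.exp (-Rk)) ≤ γ₀ / (2 * (F.P p.K).d * (100 * (M : ℝ)) ^ ((F.P p.K).d + 1)))
    (h16 : ∀ v ∈ K, Ineq16 (lin v) B₃ M₀ A₀ p₀g Rk M)
    (ℓ : BlockChartSU N b →ₗ[ℝ] ℝ) (hlin : ∀ v, lin v = ℓ v)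
    (hV : ∀ v ∈ K, |Vt v| ≤ WV)
    (Φ : (↥b × Fin (dimSU N) → ℂ) → ℂ) {r S₂ : ℝ} (hr : 0 < r)
    (hVtΦ : ∀ z ∈ K, Vt z = (Φ fun q => ((z q.1 q.2 : ℝ) : ℂ)).re)
    (hΦd : ∀ z ∈ K, DifferentiableOn ℂ Φ (ball (fun q => ((z q.1 q.2 : ℝ) : ℂ)) r))
    (hΦS : ∀ z ∈ K, ∀ w ∈ ball (fun q : ↥b × Fin (dimSU N) => ((z q.1 q.2 : ℝ) : ℂ)) r, ‖Φ w‖ ≤ S₂)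
    (hconv : 4 * (F.P p.K).d * (100 * (M : ℝ)) ^ ((F.P p.K).d + 1) * S₂ ≤ γ₀ * r ^ 2)
    -- the statistic's binders and the END clause, verbatim
    (hUL : ∀ z z' : BlockChartSU N b, U z - U z' ≤ L * ‖z - z'‖)
    (hUc : U 0 ≤ σ * θ)
    (hclause : 16 * (3 * B₃ * M₀ * A₀ ^ 2 * p₀g ^ 2 * Real.exp (-Rk) * (100 * (M : ℝ)) ^ 4 + WV) * (F.P p.K).d
      * (100 * (M : ℝ)) ^ ((F.P p.K).d + 1) * (dimSU N * L ^ 2) ≤ γ₀ * (θ * (1 - ρ - σ)) ^ 2)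
    (henv : ∀ l ∈ Icc (1 - 1 / ((b.card : ℝ) * dimSU N + 1)) 1, ∀ z : BlockChartSU N b,
      θ * (1 - ρ) ≤ U z → U z < θ → z ∈ C → l • z ∈ Env)
    (hRT : ∀ z : BlockChartSU N b, θ * (1 - ρ) ≤ U z → U z < θ → z ∈ C → ∀ s : ℝ, 1 ≤ s →
      θ * (1 - ρ) ≤ U (s • z) → U (s • z) < θ → s • z ∈ C → U z + κ₀ * (θ * (1 - ρ)) * (s - 1) ≤ U (s • z))
    (hQ : ((volume : Measure (BlockChartSU N b)).withDensity fun z =>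
        K.indicator (fun w => ENNReal.ofReal (Real.exp (-φ w))) z) (Env \ ({z | U z < θ} ∩ C))
      ≤ ENNReal.ofReal Q * ((volume : Measure (BlockChartSU N b)).withDensity fun z =>
        K.indicator (fun w => ENNReal.ofReal (Real.exp (-φ w))) z) ({z | U z < θ} ∩ C))
    -- the reading identity on the window and the density presentation
    (hread : ∀ z ∈ closedBall (0 : BlockChartSU N b) S, blockReading N u b x (expFibreChartSU b c z) = U z)
    (hdens : (fun z : BlockChartSU N b => chartWeightSU b S (expJacWeightSU (kappaSU N)) z * R (expFibreChartSU b c z))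
      =ᵐ[volume] ({z | U z < θ} ∩ C).indicator fun z => K.indicator (fun w => ENNReal.ofReal (Real.exp (-φ w))) z) :
    SlotAntiConcentration (blockFibreLawOfDatum₉ F N ϑ Dt g₀ os p g k t a b x) (blockReading N u b x) θ ρ
      (3 * ((b.card : ℝ) * dimSU N + 1) * (1 + Q) / (κ₀ * (1 - ρ))) := by
  subst hbdef
  exact fibreAC_of_sect1Letters_expChartSU_analytic_local F N ϑ Dt g₀ os p g k hN t a _ hb x hS hSπ c hR hlaw hu K φ Qf lin
    Vt hg hUm hC hEnv hθ hρ0 hρ1 hρσ hκ hQ0 hL hd (by exact_mod_cast hM) hγ₀ hW hK h0K hexp A hQf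
    (ineq19_blockChartSU_image_of_ineq17 hinj M hd hnM hM Qf hγ₀.le h17 hsmall)
    h16 ℓ hlin hV Φ hr hVtΦ hΦd hΦS hconv hUL hUc hclause henv hRT hQ hread hdens

/-- ★-img **THE SAME AT ONE TERM's FIBRE LAW** `termFibreLawOfDatum₉ … t s b x`: file 2's ★-loc
`termFibreAC_of_sect1Letters_expChartSU_analytic_local` at `d := (F.P p.K).d` with `h19` REPLACED by the block
`b = castBond '' (innerBonds n y ∖ treeBonds n y)`, the (1.7) row `h17` and the smallness line.  LOCATED junction.
[bookkeeping] -/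
theorem termFibreAC_of_sect1Letters_expChartSU_analytic_image (hN : 2 ≤ N) (t : ℝ)
    (s : SeqOfRecord F ϑ.ν ϑ.τ9.M g p.K k)
    (b : Finset (PBond (F.P p.K) k)) (hb : b.Nonempty) (x : GaugeField (F.P p.K) k (SU N))
    {S : ℝ} (hS : 0 ≤ S) (hSπ : S ≤ Real.pi) (c : GaugeField (F.P p.K) k (SU N))
    {R : (↥b → SU N) → ℝ≥0∞} (hR : Measurable R)
    (hlaw : termFibreLawOfDatum₉ F N ϑ Dt g₀ os p g k t s b x = (blockLaw b).withDensity fun y => windowSU b c S y * R y)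
    {u : GaugeField (F.P p.K) k (SU N) → ℝ} (hu : Measurable u)
    (K : Set (BlockChartSU N b)) (φ Qf lin Vt : BlockChartSU N b → ℝ)
    (hg : Measurable fun z : BlockChartSU N b => K.indicator (fun w => ENNReal.ofReal (Real.exp (-φ w))) z)
    {U : BlockChartSU N b → ℝ} (hUm : Measurable U)
    {C Env : Set (BlockChartSU N b)} (hC : MeasurableSet C) (hEnv : MeasurableSet Env)
    {θ ρ σ κ₀ Q L γ₀ B₃ M₀ A₀ p₀g Rk WV Cc εk : ℝ} (M : ℕ) {n : Fin (F.P p.K).d → ℕ}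
    (hθ : 0 < θ) (hρ0 : 0 < ρ) (hρ1 : ρ < 1) (hρσ : ρ + σ ≤ 1) (hκ : 0 < κ₀) (hQ0 : 0 ≤ Q) (hL : 0 < L)
    (hd : 1 ≤ (F.P p.K).d) (hM : 0 < M) (hγ₀ : 0 < γ₀)
    (hW : 0 ≤ 3 * B₃ * M₀ * A₀ ^ 2 * p₀g ^ 2 * Real.exp (-Rk) * (100 * (M : ℝ)) ^ 4 + WV)
    (hK : Convex ℝ K) (h0K : (0 : BlockChartSU N b) ∈ K)
    (hexp : ∀ v ∈ K, φ v = φ 0 + 1 / 2 * Qf v + lin v + Vt v)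
    (A : Matrix (↥b × Fin (dimSU N)) (↥b × Fin (dimSU N)) ℝ)
    (hQf : ∀ v, Qf v = (fun q : ↥b × Fin (dimSU N) => v q.1 q.2) ⬝ᵥ (A *ᵥ fun q => v q.1 q.2))
    (hnM : ∀ κ, n κ ≤ 100 * M) (y : Fin (F.P p.K).d → ℤ)
    (hinj : Set.InjOn (fun bd : (Fin (F.P p.K).d → ℤ) × Fin (F.P p.K).d => (⟨castSite bd.1, bd.2⟩ : PBond (F.P p.K) k))
      ↑(innerBonds n y))
    (hbdef : b = (innerBonds n y \ treeBonds n y).image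
      fun bd : (Fin (F.P p.K).d → ℤ) × Fin (F.P p.K).d => (⟨castSite bd.1, bd.2⟩ : PBond (F.P p.K) k))
    (h17 : ∀ v : BlockChartSU N b, Ineq17 (Qf v)
      (∑ q ∈ innerPlaq n y, ∑ a' : Fin (dimSU N),
        curl (fun bd => if h : (⟨castSite bd.1, bd.2⟩ : PBond (F.P p.K) k) ∈ b
            then v ⟨(⟨castSite bd.1, bd.2⟩ : PBond (F.P p.K) k), h⟩ a' else (0 : ℝ)) q.1 q.2.1 q.2.2 ^ 2)
      (∑ i, ‖v i‖ ^ 2) γ₀ Cc M Rk εk)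
    (hsmall : Cc * ((M : ℝ) ^ 6 * Rk * εk + Real.exp (-Rk)) ≤ γ₀ / (2 * (F.P p.K).d * (100 * (M : ℝ)) ^ ((F.P p.K).d + 1)))
    (h16 : ∀ v ∈ K, Ineq16 (lin v) B₃ M₀ A₀ p₀g Rk M)
    (ℓ : BlockChartSU N b →ₗ[ℝ] ℝ) (hlin : ∀ v, lin v = ℓ v)
    (hV : ∀ v ∈ K, |Vt v| ≤ WV)
    (Φ : (↥b × Fin (dimSU N) → ℂ) → ℂ) {r S₂ : ℝ} (hr : 0 < r)
    (hVtΦ : ∀ z ∈ K, Vt z = (Φ fun q => ((z q.1 q.2 : ℝ) : ℂ)).re)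
    (hΦd : ∀ z ∈ K, DifferentiableOn ℂ Φ (ball (fun q => ((z q.1 q.2 : ℝ) : ℂ)) r))
    (hΦS : ∀ z ∈ K, ∀ w ∈ ball (fun q : ↥b × Fin (dimSU N) => ((z q.1 q.2 : ℝ) : ℂ)) r, ‖Φ w‖ ≤ S₂)
    (hconv : 4 * (F.P p.K).d * (100 * (M : ℝ)) ^ ((F.P p.K).d + 1) * S₂ ≤ γ₀ * r ^ 2)
    (hUL : ∀ z z' : BlockChartSU N b, U z - U z' ≤ L * ‖z - z'‖)
    (hUc : U 0 ≤ σ * θ)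
    (hclause : 16 * (3 * B₃ * M₀ * A₀ ^ 2 * p₀g ^ 2 * Real.exp (-Rk) * (100 * (M : ℝ)) ^ 4 + WV) * (F.P p.K).d
      * (100 * (M : ℝ)) ^ ((F.P p.K).d + 1) * (dimSU N * L ^ 2) ≤ γ₀ * (θ * (1 - ρ - σ)) ^ 2)
    (henv : ∀ l ∈ Icc (1 - 1 / ((b.card : ℝ) * dimSU N + 1)) 1, ∀ z : BlockChartSU N b,
      θ * (1 - ρ) ≤ U z → U z < θ → z ∈ C → l • z ∈ Env)
    (hRT : ∀ z : BlockChartSU N b, θ * (1 - ρ) ≤ U z → U z < θ → z ∈ C → ∀ s' : ℝ, 1 ≤ s' →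
      θ * (1 - ρ) ≤ U (s' • z) → U (s' • z) < θ → s' • z ∈ C → U z + κ₀ * (θ * (1 - ρ)) * (s' - 1) ≤ U (s' • z))
    (hQ : ((volume : Measure (BlockChartSU N b)).withDensity fun z =>
        K.indicator (fun w => ENNReal.ofReal (Real.exp (-φ w))) z) (Env \ ({z | U z < θ} ∩ C))
      ≤ ENNReal.ofReal Q * ((volume : Measure (BlockChartSU N b)).withDensity fun z =>
        K.indicator (fun w => ENNReal.ofReal (Real.exp (-φ w))) z) ({z | U z < θ} ∩ C))
    (hread : ∀ z ∈ closedBall (0 : BlockChartSU N b) S, blockReading N u b x (expFibreChartSU b c z) = U z)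
    (hdens : (fun z : BlockChartSU N b => chartWeightSU b S (expJacWeightSU (kappaSU N)) z * R (expFibreChartSU b c z))
      =ᵐ[volume] ({z | U z < θ} ∩ C).indicator fun z => K.indicator (fun w => ENNReal.ofReal (Real.exp (-φ w))) z) :
    SlotAntiConcentration (termFibreLawOfDatum₉ F N ϑ Dt g₀ os p g k t s b x) (blockReading N u b x) θ ρ
      (3 * ((b.card : ℝ) * dimSU N + 1) * (1 + Q) / (κ₀ * (1 - ρ))) := by
  subst hbdef
  exact termFibreAC_of_sect1Letters_expChartSU_analytic_local F N ϑ Dt g₀ os p g k hN t s _ hb x hS hSπ c hR hlaw hu K φ Qf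
    lin Vt hg hUm hC hEnv hθ hρ0 hρ1 hρσ hκ hQ0 hL hd (by exact_mod_cast hM) hγ₀ hW hK h0K hexp A hQf
    (ineq19_blockChartSU_image_of_ineq17 hinj M hd hnM hM Qf hγ₀.le h17 hsmall)
    h16 ℓ hlin hV Φ hr hVtΦ hΦd hΦS hconv hUL hUc hclause henv hRT hQ hread hdens

end AtRecord

end Summit.QuantumFields.YangMills.Theorems.N21LowCentreEndAtSUNBlockChartRecordAnalyticAxialComb

end
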